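/-
Copyright (c) 2026. All rights reserved.
Released under Apache 2.0 license as described in the file LICENSE.
-/
import Literature.NumberTheory.ComplexMultiplication.DegenerateCMTypesElementaryAbelianPrimeSquare
import HarnessLib

/-!
# Dodson's Prop. 4.4 (2) on the minimal group `⟨ρ⟩ × ℤ₃²` as printed: the orbits of order `9` have rank
# `10` or `8` (weight `3`: rank `8`), the orbits of order `3` rank `4` or `2`; no rank `6`

B. Dodson, *On the Mumford–Tate group of an abelian variety with complex multiplication*, J. Algebra **111**
(1987) 49–73 [Dodson1987] (held text `paper:doi-10-1016-0021-8693-87-90242-0`, pp. 69–71 = p0021–p0023):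

> PROPOSITION 4.4. "(2) Suppose `R₀ = ℤ₃²` and weight(`f`) `= 3`. Then there are the following cases: (a) the
> orbits of order `9` give types with rank(`f`) `= 8` and (b) there are twelve `f` in four `ℤ₃²`-orbits of order
> `3`.  Further, in case (2b), an orbit of types consisting of the union of any two orbits corresponds to types
> with rank `6`, and such an orbit occurs for certain `G₀` properly containing `R₀ = ℤ₃²`. […] *Proof.* (2) There
> is a single Hol(`ℤ₃²`)-orbit of `ℤ₃²`-orbits of order `9`, whose types have rank `8`. The four `ℤ₃²`-orbits of
> order `3` correspond to the four subgroups isomorphic to `ℤ₃` in `ℤ₃²`, and the ranks for the union of these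
> orbits may then be checked directly."
> REMARK 4.7. "Let `A` be a simple Abelian variety with complex multiplication, and suppose that the dimension of
> `A` is `9`. Then Rank(`A`) `= 6, 8`, or `10`, and these three numbers do occur."

Sequel of `DegenerateCMTypesElementaryAbelianPrimeSquare` (row g35-#4: for every odd `p` and every CM type `S` of
`⟨ρ⟩ × (ℤ/p)²`, `rank(S) + (p − 1)·t(S) = p² + 1` with `t(S)` the number of subgroups `H` of order `p` over whose
cosets `S` is equidistributed; the imprimitive types have rank `p + 1` or `2`).  HERE, with the same frame
`(τ, κ)` and dictionary:

* §1 (every odd `p`) the `p + 1` directions pairwise as frames: `diag_not_mem_zpowers` (`(τ, τʲκ)`),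
  **`diag_not_mem_zpowers_diag`** (`(τʲκ, τʲ'κ)`, `j ≠ j'`), `tau_diag_coord`, `diag_diag_coord`,
  `rowCount_tau_diag_eq` / **`hasConstantRows_tau_diag_iff`** (equidistribution over the cosets of `⟨τ⟩` does not
  depend on the complement), `rowCount_diag_diag_eq` / `hasConstantRows_diag_diag_of`.
* §2 (every odd `p`) IMPRIMITIVE TYPES AND WEIGHT: `rowCount_eq_zero_or_of_isStableUnder`,
  `rowCount_diag_eq_zero_or_of_isStableUnder_diag` (a type stable under a subgroup of order `p` meets each of its
  cosets in `0` or `p` points — Prop. 4.1's proof), `weight_eq_zero_or_of_isStableUnder_of_hasConstantRows(_diag)`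
  (stable AND equidistributed in the same direction ⟹ weight `0` or `p²`: the two induced types),
  **`typeRank_eq_of_exists_isStableUnder_of_weight`** (an imprimitive type of weight `0 < w < p²` has rank
  EXACTLY `p + 1`).
* §3 (`p = 3`, `τ, κ` of order `3`, `|G| = 18`): **`exists_isStableUnder_of_hasConstantRows_three`** — in a
  frame `(u, v)` of `ℤ₃²`, constant counts on the cosets of `⟨u⟩` AND of `⟨v⟩` force a stabiliser `uʲv` (the
  `3 × 3` LEMMA: a `(0,1)`-matrix on `ℤ/3 × ℤ/3` with constant row and column sums is empty, full, the graph of an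
  affine bijection or its complement — all six permutations of three points are affine; checked by the kernel on
  the `2⁹` matrices, `decide`); hence **`atMostOne_direction_of_primitive_three`** /
  `directions_le_one_of_primitive_three` (a PRIMITIVE type is equidistributed in at most one direction),
  **`typeRank_eq_or_of_primitive_three`** = PROP. 4.4 (2) ("the orbits of order `9`": rank `10` or `8`),
  `typeRank_eq_eight_iff_of_primitive_three`, **`typeRank_mem_three`** (REMARK 4.7 on the minimal group: every
  type of `⟨ρ⟩ × ℤ₃²` has rank `10, 8, 4` or `2`), `typeRank_ne_six_three` (rank `6` needs `G₀ ⊋ ℤ₃²`),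
  **`typeRank_eq_eight_of_primitive_of_weight_three`** = PROP. 4.4 (2)(a) VERBATIM (weight `3`, or `6`, in an
  orbit of order `9` ⟹ rank `8`: three non-collinear points of `ℤ₃²` are a transversal of exactly one `ℤ₃`; the
  kernel checks the `84 + 84` subsets), **`typeRank_eq_four_of_exists_isStableUnder_of_weight`** ((2)(b): the
  weight-`3` orbits of order `3` — cosets of the four `ℤ₃` — have rank `4`).

Together with `CyclicCMType.PrimeSq.typeRank_mem_nine` (`⟨ρ⟩ × ℤ₉`: ranks `⊆ {10, 8, 4, 2}`) this settles Remark
4.7 for the simple abelian `9`-folds whose CM field is GALOIS with ABELIAN group (the two abelian groups of order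
`18` containing an involution with the CM property are `⟨ρ⟩ × ℤ₉` and `⟨ρ⟩ × ℤ₃²`): ranks `10` and `8` only; `6`
requires a non-abelian Galois closure (Prop. 4.6: `K₀` not Galois, `Gal(K₀ᶜ/ℚ)` a wreath product).

NOT here: the rank-`6` unions of (2)(b) (types of groups `G₀ ⊋ ℤ₃²`), Prop. 4.6, Lemma 4.2, the counts
(`342 / 144 / 24 / 2` types of rank `10 / 8 / 4 / 2` among the `512`), the number-field dress.

## References

* [Dodson1987] B. Dodson, J. Algebra 111 (1987) 49–73: §4.1 Prop. 4.1 (proof), Example 4.3, Prop. 4.4 (2) (with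
  proof); §4.2 Prop. 4.6, Remark 4.7 (pp. 69–71).
* [Kubota1965] T. Kubota, Trans. AMS 118 (1965), §4 Lemma 2.
* [Hazama2003CyclicCM] F. Hazama, J. Math. Sci. Univ. Tokyo 10 (2003): Prop. 2.3, Prop. 4.3, Lemma 4.6.1.

## Provenance

Lane `lit-hodgefound` (Track 2, Layer A3 — CM types), seat `lit-hodgefound-p10` generation 35, row g35-#5;
neighbours cited by name, nothing restated: `DegenerateCMTypesElementaryAbelianPrimeSquare` (frame, defect formula,
stabilisers), `DegenerateCMTypesCyclicTwoOddPrimes` (`rowCount`, `HasConstantRows`, `IsStableUnder`),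
`CMTypeRankCharacters` (Kubota's Lemma 2).
-/

set_option autoImplicit false

noncomputable section

open scoped BigOperators

namespace Literature.NumberTheory.ComplexMultiplication

namespace CyclicCMType

namespace ElemSq

/-! ## §1 More frame algebra: the `p + 1` directions pairwise as frames -/

section Frames

variable {G : Type*} [CommGroup G] [Fintype G] [DecidableEq G] {p : ℕ} [hp : Fact p.Prime] {ρ τ κ : G}
  {Φ : Finset G}

omit [Fintype G] [DecidableEq G] in
/-- `τ^{(n : ℤ/p).val} = τⁿ` for `τ` of order `p`. [folklore] -/
private theorem pow_val_natCast' (hτ : orderOf τ = p) (n : ℕ) : τ ^ (n : ZMod p).val = τ ^ n := by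
  haveI : NeZero p := ⟨hp.out.ne_zero⟩
  rw [ZMod.val_natCast, ← hτ, pow_mod_orderOf]

omit [Fintype G] [DecidableEq G] in
/-- Normal forms: `τᵃκᵇ = τᵃ'κᵇ'` as soon as `a ≡ a'`, `b ≡ b' (mod p)`. [folklore] -/
private theorem coord_congr' (hτ : orderOf τ = p) (hκ : orderOf κ = p) {a a' b b' : ℕ}
    (ha : (a : ZMod p) = a') (hb : (b : ZMod p) = b') : τ ^ a * κ ^ b = τ ^ a' * κ ^ b' := by
  rw [← pow_val_natCast' hτ a, ← pow_val_natCast' hτ a', ← pow_val_natCast' hκ b, ← pow_val_natCast' hκ b',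
    ha, hb]

omit [Fintype G] [DecidableEq G] in
/-- `τ^{(x + x').val} = τ^{x.val} τ^{x'.val}` for `τ` of order `p`. [folklore] -/
private theorem pow_val_add' (hτ : orderOf τ = p) (x x' : ZMod p) :
    τ ^ (x + x').val = τ ^ x.val * τ ^ x'.val := by
  haveI : NeZero p := ⟨hp.out.ne_zero⟩
  have h := pow_mod_orderOf τ (x.val + x'.val)
  rw [hτ] at h
  rw [ZMod.val_add, h, pow_add]

omit [Fintype G] [DecidableEq G] in
/-- `τ^{(1 : ℤ/p).val} = τ`. [folklore] -/
private theorem pow_val_one' : τ ^ (1 : ZMod p).val = τ := by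
  haveI : Fact (1 < p) := ⟨hp.out.one_lt⟩
  rw [ZMod.val_one, pow_one]

omit [Fintype G] [DecidableEq G] in
/-- `τʲκ · τᵃκᵇ = τ^{a+j} κ^{b+1}`. [folklore] -/
private theorem diag_mul_coord' (hτ : orderOf τ = p) (hκ : orderOf κ = p) (j a b : ZMod p) :
    τ ^ j.val * κ * (τ ^ a.val * κ ^ b.val) = τ ^ (a + j).val * κ ^ (b + 1).val := by
  rw [pow_val_add' hτ, pow_val_add' hκ, pow_val_one']; ac_rfl

omit [Fintype G] [DecidableEq G] in
/-- `τ · τᵃκᵇ = τ^{a+1} κᵇ`. [folklore] -/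
private theorem tau_mul_coord' (hτ : orderOf τ = p) (a b : ZMod p) :
    τ * (τ ^ a.val * κ ^ b.val) = τ ^ (a + 1).val * κ ^ b.val := by
  rw [pow_val_add' hτ, pow_val_one']; ac_rfl

omit [Fintype G] [DecidableEq G] in
/-- **`τʲκ ∉ ⟨τ⟩`**: `(τ, τʲκ)` is a frame. [cite: Dodson1987, Example 4.3] -/
theorem diag_not_mem_zpowers (hτκ : κ ∉ Subgroup.zpowers τ) (j : ℕ) : τ ^ j * κ ∉ Subgroup.zpowers τ := by
  intro hmem
  apply hτκ
  have := mul_mem (inv_mem (pow_mem (Subgroup.mem_zpowers τ) j)) hmem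
  rwa [inv_mul_cancel_left] at this

omit [DecidableEq G] in
/-- **`τʲ'κ ∉ ⟨τʲκ⟩` for `j ≠ j'`**: two distinct diagonal directions form a frame. [cite: Dodson1987, Example 4.3] -/
theorem diag_not_mem_zpowers_diag (hτ : orderOf τ = p) (hκ : orderOf κ = p) (hτκ : κ ∉ Subgroup.zpowers τ)
    {j j' : ZMod p} (hjj' : j ≠ j') : τ ^ j'.val * κ ∉ Subgroup.zpowers (τ ^ j.val * κ) := by
  haveI : NeZero p := ⟨hp.out.ne_zero⟩
  intro hmem
  -- `τ^{j − j'}`-type element `τʲκ (τʲ'κ)⁻¹ = τ^{j.val} τ^{-(j'.val)}` lies in `⟨τʲκ⟩`, and generates `⟨τ⟩`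
  have hdiff : τ ^ j.val * (τ ^ j'.val)⁻¹ ∈ Subgroup.zpowers (τ ^ j.val * κ) := by
    have := mul_mem (Subgroup.mem_zpowers (τ ^ j.val * κ)) (inv_mem hmem)
    rwa [mul_inv_rev, ← mul_assoc, mul_assoc (τ ^ j.val), mul_inv_cancel, mul_one] at this
  have heq : τ ^ j.val * (τ ^ j'.val)⁻¹ = τ ^ (j - j').val := by
    rw [mul_inv_eq_iff_eq_mul, ← pow_val_add' hτ, sub_add_cancel]
  rw [heq] at hdiff
  -- `τ = (τ^{(j-j').val})^{m}` with `m = ((j-j')⁻¹).val`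
  have hne : j - j' ≠ 0 := sub_ne_zero.2 hjj'
  have hτmem : τ ∈ Subgroup.zpowers (τ ^ j.val * κ) := by
    have := pow_mem hdiff ((j - j')⁻¹).val
    rwa [← pow_mul, ← pow_val_natCast' hτ ((j - j').val * ((j - j')⁻¹).val), Nat.cast_mul,
      ZMod.natCast_zmod_val, ZMod.natCast_zmod_val, mul_inv_cancel₀ hne, pow_val_one'] at this
  exact (frame_change hτ hκ hτκ j.val).2 hτmem

omit [Fintype G] [DecidableEq G] in
/-- `τˣ (τʲκ)ʸ = τ^{x+jy} κʸ`: the cosets of `⟨τ⟩` indexed through `τʲκ` are the cosets `κʸ⟨τ⟩`.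
[cite: Dodson1987, Prop. 4.4 (2) (proof)] -/
theorem tau_diag_coord (hτ : orderOf τ = p) (hκ : orderOf κ = p) (x j y : ZMod p) :
    τ ^ x.val * (τ ^ j.val * κ) ^ y.val = τ ^ (x + j * y).val * κ ^ y.val := by
  haveI : NeZero p := ⟨hp.out.ne_zero⟩
  rw [mul_pow, ← pow_mul, ← mul_assoc, ← pow_add]
  refine coord_congr' hτ hκ ?_ rfl
  simp only [Nat.cast_add, Nat.cast_mul, ZMod.natCast_zmod_val]

omit [Fintype G] [DecidableEq G] in
/-- `(τʲκ)ʸ (τʲ'κ)ᵗ = τ^{jy+j't} κ^{y+t}`. [cite: Dodson1987, Prop. 4.4 (2) (proof)] -/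
theorem diag_diag_coord (hτ : orderOf τ = p) (hκ : orderOf κ = p) (j j' y t : ZMod p) :
    (τ ^ j.val * κ) ^ y.val * (τ ^ j'.val * κ) ^ t.val = τ ^ (j * y + j' * t).val * κ ^ (y + t).val := by
  haveI : NeZero p := ⟨hp.out.ne_zero⟩
  rw [mul_pow, mul_pow, ← pow_mul, ← pow_mul, mul_mul_mul_comm, ← pow_add, ← pow_add]
  refine coord_congr' hτ hκ ?_ ?_
  · simp only [Nat.cast_add, Nat.cast_mul, ZMod.natCast_zmod_val]
  · simp only [Nat.cast_add, ZMod.natCast_zmod_val]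

/-- Re-indexing a count along a translation of `ℤ/p`. [folklore] -/
private theorem card_filter_add_eq' (P : ZMod p → Prop) [DecidablePred P] (d : ZMod p) :
    (Finset.univ.filter fun x => P (x + d)).card = (Finset.univ.filter P).card := by
  refine Finset.card_bij (fun x _ => x + d) (fun x hx => ?_) (fun x _ x' _ hxx' => add_right_cancel hxx')
    (fun x' hx' => ⟨x' - d, ?_, sub_add_cancel x' d⟩)
  · simpa using hx
  · simpa using hx'

omit [Fintype G] in
/-- **The row counts of the frame `(τ, τʲκ)` are those of `(τ, κ)`** (same cosets `κʸ⟨τ⟩ = (τʲκ)ʸ⟨τ⟩`).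
[cite: Dodson1987, Prop. 4.4 (2) (proof)] -/
theorem rowCount_tau_diag_eq (hτ : orderOf τ = p) (hκ : orderOf κ = p) (j y : ZMod p) :
    haveI : NeZero p := ⟨hp.out.ne_zero⟩
    rowCount p p Φ τ (τ ^ j.val * κ) y = rowCount p p Φ τ κ y := by
  haveI : NeZero p := ⟨hp.out.ne_zero⟩
  unfold rowCount
  rw [← card_filter_add_eq' (fun x : ZMod p => τ ^ x.val * κ ^ y.val ∈ Φ) (j * y)]
  congr 1
  exact Finset.filter_congr fun x _ => by rw [tau_diag_coord hτ hκ]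

omit [Fintype G] in
/-- `HasConstantRows p p S τ (τʲκ) ↔ HasConstantRows p p S τ κ`: equidistribution over the cosets of `⟨τ⟩` does
not depend on the complement chosen. [cite: Dodson1987, Prop. 4.4 (2) (proof)] -/
theorem hasConstantRows_tau_diag_iff (hτ : orderOf τ = p) (hκ : orderOf κ = p) (j : ZMod p) :
    haveI : NeZero p := ⟨hp.out.ne_zero⟩
    HasConstantRows p p Φ τ (τ ^ j.val * κ) ↔ HasConstantRows p p Φ τ κ := by
  haveI : NeZero p := ⟨hp.out.ne_zero⟩
  unfold HasConstantRows
  simp_rw [rowCount_tau_diag_eq hτ hκ]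

omit [Fintype G] in
/-- **The row counts of the frame `(τʲκ, τʲ'κ)`**, `j ≠ j'`, are those of `(τʲκ, τ)` re-indexed by
`t ↦ (j' − j)t`. [cite: Dodson1987, Prop. 4.4 (2) (proof)] -/
theorem rowCount_diag_diag_eq (hτ : orderOf τ = p) (hκ : orderOf κ = p) (j j' t : ZMod p) :
    haveI : NeZero p := ⟨hp.out.ne_zero⟩
    rowCount p p Φ (τ ^ j.val * κ) (τ ^ j'.val * κ) t = rowCount p p Φ (τ ^ j.val * κ) τ ((j' - j) * t) := by
  haveI : NeZero p := ⟨hp.out.ne_zero⟩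
  rw [rowCount_diag hτ hκ]
  unfold rowCount
  rw [← card_filter_add_eq' (fun y : ZMod p => τ ^ (j * y + (j' - j) * t).val * κ ^ y.val ∈ Φ) t]
  congr 1
  refine Finset.filter_congr fun y _ => ?_
  rw [diag_diag_coord hτ hκ]
  have e : j * (y + t) + (j' - j) * t = j * y + j' * t := by ring
  rw [e]

omit [Fintype G] in
/-- Equidistribution over the cosets of `⟨τʲκ⟩` read in the frame `(τʲκ, τʲ'κ)`, `j ≠ j'`.
[cite: Dodson1987, Prop. 4.4 (2) (proof)] -/
theorem hasConstantRows_diag_diag_of (hτ : orderOf τ = p) (hκ : orderOf κ = p) (j j' : ZMod p)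
    (hr : haveI : NeZero p := ⟨hp.out.ne_zero⟩; HasConstantRows p p Φ (τ ^ j.val * κ) τ) :
    haveI : NeZero p := ⟨hp.out.ne_zero⟩
    HasConstantRows p p Φ (τ ^ j.val * κ) (τ ^ j'.val * κ) := by
  intro t t'
  rw [rowCount_diag_diag_eq hτ hκ, rowCount_diag_diag_eq hτ hκ]
  exact hr _ _

end Frames

/-! ## §2 Imprimitive types: the weight decides between the ranks `p + 1` and `2` -/

section Imprimitive

variable {G : Type*} [CommGroup G] [Fintype G] [DecidableEq G] {p : ℕ} [hp : Fact p.Prime] {ρ τ κ : G}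
  {Φ : Finset G}

/-- A `1`-periodic predicate on `ℤ/p` is constant. [folklore] -/
private theorem forall_iff_of_periodic {P : ZMod p → Prop} (hP : ∀ t, P t ↔ P (t + 1)) (t : ZMod p) :
    P t ↔ P 0 := by
  haveI : NeZero p := ⟨hp.out.ne_zero⟩
  have hn : ∀ n : ℕ, P (n : ZMod p) ↔ P 0 := by
    intro n
    induction n with
    | zero => rw [Nat.cast_zero]
    | succ n ih => rw [Nat.cast_succ, ← hP, ih]
  rw [← ZMod.natCast_zmod_val t]
  exact hn t.val

/-- Under a `1`-periodic predicate the count over `ℤ/p` is `0` or `p`. [folklore] -/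
private theorem card_filter_eq_zero_or_of_periodic {P : ZMod p → Prop} [DecidablePred P]
    (hP : ∀ t, P t ↔ P (t + 1)) :
    (Finset.univ.filter P).card = 0 ∨ (Finset.univ.filter P).card = p := by
  by_cases h0 : P 0
  · right
    rw [Finset.filter_true_of_mem fun t _ => (forall_iff_of_periodic hP t).2 h0, Finset.card_univ, ZMod.card]
  · left
    rw [Finset.card_eq_zero, Finset.filter_eq_empty_iff]
    exact fun t _ ht => h0 ((forall_iff_of_periodic hP t).1 ht)

/-- **A `τ`-stable type meets each coset of `⟨τ⟩` in `0` or `p` points.** [cite: Dodson1987, Prop. 4.1 (proof: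
"the coordinates of `f` are constant on the orbits of the subgroup")] -/
theorem rowCount_eq_zero_or_of_isStableUnder (hp2 : p ≠ 2) (hτ : orderOf τ = p) (hκ : orderOf κ = p)
    (hτκ : κ ∉ Subgroup.zpowers τ) (hcard : Fintype.card G = 2 * p ^ 2) (h : IsCMTypeWith ρ (Φ : Set G))
    (hst : IsStableUnder Φ τ) (y : ZMod p) :
    haveI : NeZero p := ⟨hp.out.ne_zero⟩
    rowCount p p Φ τ κ y = 0 ∨ rowCount p p Φ τ κ y = p := by
  have H := (isStableUnder_iff_coord hp2 hτ hκ hτκ hcard h τ).1 hst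
  unfold rowCount
  exact card_filter_eq_zero_or_of_periodic fun x => by rw [H x y, tau_mul_coord' hτ]

/-- **A `τʲκ`-stable type meets each coset of `⟨τʲκ⟩` in `0` or `p` points.** [cite: Dodson1987, Prop. 4.1 (proof)] -/
theorem rowCount_diag_eq_zero_or_of_isStableUnder_diag (hp2 : p ≠ 2) (hτ : orderOf τ = p)
    (hκ : orderOf κ = p) (hτκ : κ ∉ Subgroup.zpowers τ) (hcard : Fintype.card G = 2 * p ^ 2)
    (h : IsCMTypeWith ρ (Φ : Set G)) (j : ZMod p) (hst : IsStableUnder Φ (τ ^ j.val * κ)) (t : ZMod p) :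
    haveI : NeZero p := ⟨hp.out.ne_zero⟩
    rowCount p p Φ (τ ^ j.val * κ) τ t = 0 ∨ rowCount p p Φ (τ ^ j.val * κ) τ t = p := by
  have H := (isStableUnder_iff_coord hp2 hτ hκ hτκ hcard h (τ ^ j.val * κ)).1 hst
  rw [rowCount_diag hτ hκ]
  refine card_filter_eq_zero_or_of_periodic fun y => ?_
  rw [H (j * y + t) y, diag_mul_coord' hτ hκ]
  have e : j * y + t + j = j * (y + 1) + t := by ring
  rw [e]

/-- **The weight of an imprimitive type with an equidistributed stabiliser direction is `0` or `p²`**: if `τ`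
stabilises `S` and the cosets of `⟨τ⟩` carry constant counts, then `S ∩ (ℤ/p)² = ∅` or `S ⊇ (ℤ/p)²` (the two
types induced from `⟨ρ⟩`). [cite: Dodson1987, Prop. 4.1 (proof: "this cannot occur unless `k = 0, 3, 6`, or `9`")] -/
theorem weight_eq_zero_or_of_isStableUnder_of_hasConstantRows (hp2 : p ≠ 2) (hτ : orderOf τ = p)
    (hκ : orderOf κ = p) (hτκ : κ ∉ Subgroup.zpowers τ) (hcard : Fintype.card G = 2 * p ^ 2)
    (h : IsCMTypeWith ρ (Φ : Set G)) (hst : IsStableUnder Φ τ)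
    (hr : haveI : NeZero p := ⟨hp.out.ne_zero⟩; HasConstantRows p p Φ τ κ) :
    (Finset.univ.filter fun xy : ZMod p × ZMod p => τ ^ xy.1.val * κ ^ xy.2.val ∈ Φ).card = 0 ∨
      (Finset.univ.filter fun xy : ZMod p × ZMod p => τ ^ xy.1.val * κ ^ xy.2.val ∈ Φ).card = p ^ 2 := by
  haveI : NeZero p := ⟨hp.out.ne_zero⟩
  rw [← sum_rowCount_eq p p Φ τ κ, Finset.sum_congr rfl fun y _ => hr y 0, Finset.sum_const, Finset.card_univ,
    ZMod.card, smul_eq_mul]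
  rcases rowCount_eq_zero_or_of_isStableUnder hp2 hτ hκ hτκ hcard h hst 0 with h0 | h0
  · left; rw [h0, mul_zero]
  · right; rw [h0, sq]

/-- The same for a diagonal stabiliser `τʲκ`. [cite: Dodson1987, Prop. 4.1 (proof)] -/
theorem weight_eq_zero_or_of_isStableUnder_diag_of_hasConstantRows (hp2 : p ≠ 2) (hτ : orderOf τ = p)
    (hκ : orderOf κ = p) (hτκ : κ ∉ Subgroup.zpowers τ) (hcard : Fintype.card G = 2 * p ^ 2)
    (h : IsCMTypeWith ρ (Φ : Set G)) (j : ZMod p) (hst : IsStableUnder Φ (τ ^ j.val * κ))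
    (hr : haveI : NeZero p := ⟨hp.out.ne_zero⟩; HasConstantRows p p Φ (τ ^ j.val * κ) τ) :
    (Finset.univ.filter fun xy : ZMod p × ZMod p => τ ^ xy.1.val * κ ^ xy.2.val ∈ Φ).card = 0 ∨
      (Finset.univ.filter fun xy : ZMod p × ZMod p => τ ^ xy.1.val * κ ^ xy.2.val ∈ Φ).card = p ^ 2 := by
  haveI : NeZero p := ⟨hp.out.ne_zero⟩
  rw [← card_filter_diag_eq hτ hκ j, ← sum_rowCount_eq p p Φ (τ ^ j.val * κ) τ,
    Finset.sum_congr rfl fun t _ => hr t 0, Finset.sum_const, Finset.card_univ, ZMod.card, smul_eq_mul]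
  rcases rowCount_diag_eq_zero_or_of_isStableUnder_diag hp2 hτ hκ hτκ hcard h j hst 0 with h0 | h0
  · left; rw [h0, mul_zero]
  · right; rw [h0, sq]

/-- **An imprimitive type of weight `0 < w < p²` has rank `p + 1`** (`w = #(S ∩ (ℤ/p)²)`; the stabiliser
direction is not equidistributed, the `p` others are): Dodson's `ℤ₃²`-orbits of order `3` of weight `3` have
rank `4`. [cite: Dodson1987, Prop. 4.4 (2)(b)] [cite: Kubota1965, §4 Lemma 2] -/
theorem typeRank_eq_of_exists_isStableUnder_of_weight (hp2 : p ≠ 2) (hτ : orderOf τ = p) (hκ : orderOf κ = p)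
    (hτκ : κ ∉ Subgroup.zpowers τ) (hcard : Fintype.card G = 2 * p ^ 2) (h : IsCMTypeWith ρ (Φ : Set G))
    (hst : ∃ u : G, u ≠ 1 ∧ IsStableUnder Φ u)
    (hw0 : 0 < (Finset.univ.filter fun xy : ZMod p × ZMod p => τ ^ xy.1.val * κ ^ xy.2.val ∈ Φ).card)
    (hw : (Finset.univ.filter fun xy : ZMod p × ZMod p => τ ^ xy.1.val * κ ^ xy.2.val ∈ Φ).card < p ^ 2) :
    typeRank G (Φ : Set G) = p + 1 := by
  haveI : NeZero p := ⟨hp.out.ne_zero⟩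
  classical
  rcases (exists_isStableUnder_iff hp2 hτ hκ hτκ hcard h).1 hst with hst | ⟨j, hst⟩
  · have key := typeRank_add_eq_of_isStableUnder hp2 hτ hκ hτκ hcard h hst
    have hr : ¬ HasConstantRows p p Φ τ κ := fun hr => by
      rcases weight_eq_zero_or_of_isStableUnder_of_hasConstantRows hp2 hτ hκ hτκ hcard h hst hr with e | e <;>
        omega
    rw [if_neg hr, add_zero] at key
    exact key
  · have key := typeRank_add_eq_of_isStableUnder_diag hp2 hτ hκ hτκ hcard h j hst
    have hr : ¬ HasConstantRows p p Φ (τ ^ j.val * κ) τ := fun hr => by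
      rcases weight_eq_zero_or_of_isStableUnder_diag_of_hasConstantRows hp2 hτ hκ hτκ hcard h j hst hr with
        e | e <;> omega
    rw [if_neg hr, add_zero] at key
    exact key

end Imprimitive

/-! ## §3 `p = 3`: two directions of equidistribution force a stabiliser (the `3 × 3` lemma) -/

section Three

variable {G : Type*} [CommGroup G] [Fintype G] [DecidableEq G] {ρ τ κ : G} {Φ : Finset G}

/-- **The `3 × 3` lemma**: a `(0,1)`-matrix on `ℤ/3 × ℤ/3` with constant row sums AND constant column sums is
invariant under the translation `(a, b) ↦ (a + j, b + 1)` for some `j ≠ 0` — it is empty, full, the graph of an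
affine bijection of `ℤ/3` (every permutation of three points is affine) or the complement of one.  Checked by
the kernel on the `2⁹` matrices. [folklore] -/
private theorem three_by_three : ∀ M : Finset (ZMod 3 × ZMod 3),
    (∀ y y' : ZMod 3, (Finset.univ.filter fun x : ZMod 3 => (x, y) ∈ M).card =
      (Finset.univ.filter fun x : ZMod 3 => (x, y') ∈ M).card) →
    (∀ x x' : ZMod 3, (Finset.univ.filter fun y : ZMod 3 => (x, y) ∈ M).card =
      (Finset.univ.filter fun y : ZMod 3 => (x', y) ∈ M).card) →
    ∃ j : ZMod 3, j ≠ 0 ∧ ∀ ab : ZMod 3 × ZMod 3, ab ∈ M ↔ (ab.1 + j, ab.2 + 1) ∈ M := by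
  decide +kernel

/-- **Weight `3` or `6` on `ℤ/3 × ℤ/3`**: a `3`- or `6`-subset invariant under no translation `(1, 0)`, `(j, 1)` is
equidistributed over the cosets of `⟨(1,0)⟩` or of some `⟨(j,1)⟩` (three non-collinear points have three pairwise
differences in three distinct directions, so they form a transversal of the fourth).  Checked by the kernel.
[folklore] -/
private theorem three_points : ∀ M : Finset (ZMod 3 × ZMod 3), (M.card = 3 ∨ M.card = 6) →
    (¬ ∀ ab : ZMod 3 × ZMod 3, ab ∈ M ↔ (ab.1 + 1, ab.2) ∈ M) →
    (∀ j : ZMod 3, ¬ ∀ ab : ZMod 3 × ZMod 3, ab ∈ M ↔ (ab.1 + j, ab.2 + 1) ∈ M) →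
    (∀ y y' : ZMod 3, (Finset.univ.filter fun x : ZMod 3 => (x, y) ∈ M).card =
      (Finset.univ.filter fun x : ZMod 3 => (x, y') ∈ M).card) ∨
    ∃ j : ZMod 3, ∀ t t' : ZMod 3, (Finset.univ.filter fun y : ZMod 3 => (j * y + t, y) ∈ M).card =
      (Finset.univ.filter fun y : ZMod 3 => (j * y + t', y) ∈ M).card := by
  decide +kernel

/-- **Two directions of equidistribution force a stabiliser (`p = 3`)**: for a frame `(u, v)` of `ℤ₃²`, a CM type
of `⟨ρ⟩ × ℤ₃²` with constant counts on the cosets of `⟨u⟩` AND of `⟨v⟩` is stable under some `uʲv` — it is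
imprimitive ("the ranks for the union of these orbits may then be checked directly"; here: the `3 × 3` lemma).
[cite: Dodson1987, Prop. 4.4 (2) (proof)] -/
theorem exists_isStableUnder_of_hasConstantRows_three {u v : G} (hu : orderOf u = 3) (hv : orderOf v = 3)
    (huv : v ∉ Subgroup.zpowers u) (hcard : Fintype.card G = 18) (h : IsCMTypeWith ρ (Φ : Set G))
    (hr : HasConstantRows 3 3 Φ u v) (hc : HasConstantRows 3 3 Φ v u) :
    ∃ w : G, w ≠ 1 ∧ IsStableUnder Φ w := by
  have hcard' : Fintype.card G = 2 * 3 ^ 2 := by rw [hcard]; norm_num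
  set M : Finset (ZMod 3 × ZMod 3) :=
    Finset.univ.filter fun ab : ZMod 3 × ZMod 3 => u ^ ab.1.val * v ^ ab.2.val ∈ Φ with hM
  have hmem : ∀ a b : ZMod 3, (a, b) ∈ M ↔ u ^ a.val * v ^ b.val ∈ Φ := fun a b => by
    simp only [hM, Finset.mem_filter, Finset.mem_univ, true_and]
  have hrows : ∀ y y' : ZMod 3, (Finset.univ.filter fun x : ZMod 3 => (x, y) ∈ M).card =
      (Finset.univ.filter fun x : ZMod 3 => (x, y') ∈ M).card := by
    intro y y'
    have := hr y y'
    unfold rowCount at this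
    simp_rw [hmem]
    exact this
  have hcols : ∀ x x' : ZMod 3, (Finset.univ.filter fun y : ZMod 3 => (x, y) ∈ M).card =
      (Finset.univ.filter fun y : ZMod 3 => (x', y) ∈ M).card := by
    intro x x'
    have := hc x x'
    unfold rowCount at this
    simp_rw [hmem, mul_comm (u ^ _)]
    exact this
  obtain ⟨j, hj0, hj⟩ := three_by_three M hrows hcols
  refine ⟨u ^ j.val * v, fun h1 => ?_, ?_⟩
  · have := (frame_change hu hv huv j.val).1
    rw [h1, orderOf_one] at this
    exact absurd this (by norm_num)
  · rw [isStableUnder_iff_coord (by norm_num) hu hv huv hcard' h]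
    intro a b
    rw [diag_mul_coord' hu hv, ← hmem, ← hmem]
    exact hj (a, b)

/-- **A PRIMITIVE type of `⟨ρ⟩ × ℤ₃²` is equidistributed over the cosets of AT MOST ONE `ℤ₃ ⊂ ℤ₃²`** (two
directions would give a stabiliser, by the `3 × 3` lemma in the frame they span).
[cite: Dodson1987, Prop. 4.4 (2)(a) (proof: "a single Hol(`ℤ₃²`)-orbit of `ℤ₃²`-orbits of order `9`, whose types
have rank `8`")] -/
theorem atMostOne_direction_of_primitive_three (hτ : orderOf τ = 3) (hκ : orderOf κ = 3)
    (hτκ : κ ∉ Subgroup.zpowers τ) (hcard : Fintype.card G = 18) (h : IsCMTypeWith ρ (Φ : Set G))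
    (hprim : ∀ u : G, u ≠ 1 → ¬ IsStableUnder Φ u) :
    (HasConstantRows 3 3 Φ τ κ → ∀ j : ZMod 3, ¬ HasConstantRows 3 3 Φ (τ ^ j.val * κ) τ) ∧
      ∀ j j' : ZMod 3, HasConstantRows 3 3 Φ (τ ^ j.val * κ) τ →
        HasConstantRows 3 3 Φ (τ ^ j'.val * κ) τ → j = j' := by
  refine ⟨fun hr j hj => ?_, fun j j' hj hj' => ?_⟩
  · -- the frame `(τ, τʲκ)`
    obtain ⟨w, hw1, hw⟩ := exists_isStableUnder_of_hasConstantRows_three hτ (frame_change hτ hκ hτκ j.val).1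
      (diag_not_mem_zpowers hτκ j.val) hcard h ((hasConstantRows_tau_diag_iff hτ hκ j).2 hr) hj
    exact hprim w hw1 hw
  · -- the frame `(τʲκ, τʲ'κ)`
    by_contra hjj'
    obtain ⟨w, hw1, hw⟩ := exists_isStableUnder_of_hasConstantRows_three (frame_change hτ hκ hτκ j.val).1
      (frame_change hτ hκ hτκ j'.val).1 (diag_not_mem_zpowers_diag hτ hκ hτκ hjj') hcard h
      (hasConstantRows_diag_diag_of hτ hκ j j' hj) (hasConstantRows_diag_diag_of hτ hκ j' j hj')
    exact hprim w hw1 hw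

open scoped Classical in
/-- The number of directions of a primitive type of `⟨ρ⟩ × ℤ₃²` is `0` or `1`. [cite: Dodson1987, Prop. 4.4 (2)(a)] -/
theorem directions_le_one_of_primitive_three (hτ : orderOf τ = 3) (hκ : orderOf κ = 3)
    (hτκ : κ ∉ Subgroup.zpowers τ) (hcard : Fintype.card G = 18) (h : IsCMTypeWith ρ (Φ : Set G))
    (hprim : ∀ u : G, u ≠ 1 → ¬ IsStableUnder Φ u) :
    (if HasConstantRows 3 3 Φ τ κ then 1 else 0) +
        (Finset.univ.filter fun j : ZMod 3 => HasConstantRows 3 3 Φ (τ ^ j.val * κ) τ).card ≤ 1 := by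
  obtain ⟨h1, h2⟩ := atMostOne_direction_of_primitive_three hτ hκ hτκ hcard h hprim
  have hle : (Finset.univ.filter fun j : ZMod 3 => HasConstantRows 3 3 Φ (τ ^ j.val * κ) τ).card ≤ 1 :=
    Finset.card_le_one.2 fun j hj j' hj' => h2 j j' (Finset.mem_filter.1 hj).2 (Finset.mem_filter.1 hj').2
  split_ifs with hr
  · rw [Finset.filter_false_of_mem fun j _ => h1 hr j, Finset.card_empty]
  · rwa [zero_add]

open scoped Classical in
/-- **Prop. 4.4 (2) for `R₀ = ℤ₃²`: the orbits of order `9` give types of rank `10` or `8`** — rank `8` iff the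
type is equidistributed over the cosets of (exactly) one `ℤ₃ ⊂ ℤ₃²`.
[cite: Dodson1987, Prop. 4.4 (2)(a)] [cite: Kubota1965, §4 Lemma 2] -/
theorem typeRank_eq_or_of_primitive_three (hτ : orderOf τ = 3) (hκ : orderOf κ = 3)
    (hτκ : κ ∉ Subgroup.zpowers τ) (hcard : Fintype.card G = 18) (h : IsCMTypeWith ρ (Φ : Set G))
    (hprim : ∀ u : G, u ≠ 1 → ¬ IsStableUnder Φ u) :
    typeRank G (Φ : Set G) = 10 ∨ typeRank G (Φ : Set G) = 8 := by
  have key := typeRank_add_defect_eq_nine hτ hκ hτκ hcard h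
  have hle := directions_le_one_of_primitive_three hτ hκ hτκ hcard h hprim
  omega

open scoped Classical in
/-- **Rank `8` iff one direction of equidistribution** (for a primitive type of `⟨ρ⟩ × ℤ₃²`).
[cite: Dodson1987, Prop. 4.4 (2)(a)] -/
theorem typeRank_eq_eight_iff_of_primitive_three (hτ : orderOf τ = 3) (hκ : orderOf κ = 3)
    (hτκ : κ ∉ Subgroup.zpowers τ) (hcard : Fintype.card G = 18) (h : IsCMTypeWith ρ (Φ : Set G))
    (hprim : ∀ u : G, u ≠ 1 → ¬ IsStableUnder Φ u) :
    typeRank G (Φ : Set G) = 8 ↔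
      HasConstantRows 3 3 Φ τ κ ∨ ∃ j : ZMod 3, HasConstantRows 3 3 Φ (τ ^ j.val * κ) τ := by
  rw [← typeRank_ne_iff (p := 3) (by norm_num) hτ hκ hτκ (by rw [hcard]; norm_num) h]
  have := typeRank_eq_or_of_primitive_three hτ hκ hτκ hcard h hprim
  omega

/-- **Remark 4.7 on the minimal group `⟨ρ⟩ × ℤ₃²`: every CM type has rank `10`, `8`, `4` or `2`** (primitive:
`10`, `8`; orbits of order `3`: `4`, `2` — the value `6` of Remark 4.7 needs a Galois group `G₀ ⊋ ℤ₃²`,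
Prop. 4.4 (2b) / Prop. 4.6). [cite: Dodson1987, Prop. 4.4 (2) and Remark 4.7] -/
theorem typeRank_mem_three (hτ : orderOf τ = 3) (hκ : orderOf κ = 3) (hτκ : κ ∉ Subgroup.zpowers τ)
    (hcard : Fintype.card G = 18) (h : IsCMTypeWith ρ (Φ : Set G)) :
    typeRank G (Φ : Set G) ∈ ({10, 8, 4, 2} : Finset ℕ) := by
  simp only [Finset.mem_insert, Finset.mem_singleton]
  by_cases hprim : ∀ u : G, u ≠ 1 → ¬ IsStableUnder Φ u
  · rcases typeRank_eq_or_of_primitive_three hτ hκ hτκ hcard h hprim with e | e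
    · exact Or.inl e
    · exact Or.inr (Or.inl e)
  · simp only [not_forall, not_not] at hprim
    obtain ⟨u, hu1, hu⟩ := hprim
    rcases typeRank_eq_or_of_exists_isStableUnder_nine hτ hκ hτκ hcard h ⟨u, hu1, hu⟩ with e | e
    · exact Or.inr (Or.inr (Or.inl e))
    · exact Or.inr (Or.inr (Or.inr e))

/-- **Rank `6` does not occur on `⟨ρ⟩ × ℤ₃²`.** [cite: Dodson1987, Prop. 4.4 (2) and Remark 4.7] -/
theorem typeRank_ne_six_three (hτ : orderOf τ = 3) (hκ : orderOf κ = 3) (hτκ : κ ∉ Subgroup.zpowers τ)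
    (hcard : Fintype.card G = 18) (h : IsCMTypeWith ρ (Φ : Set G)) : typeRank G (Φ : Set G) ≠ 6 := by
  have := typeRank_mem_three hτ hκ hτκ hcard h
  simp only [Finset.mem_insert, Finset.mem_singleton] at this
  omega

/-- **Prop. 4.4 (2)(a) AS PRINTED: "Suppose `R₀ = ℤ₃²` and weight(`f`) `= 3`. Then (a) the orbits of order `9`
give types with rank(`f`) `= 8`"** — a primitive type with `3` (or, by `f ↔ ρf`, `6`) points in `ℤ₃²` is
equidistributed in exactly one direction (three non-collinear points are a transversal of exactly one
`ℤ₃ ⊂ ℤ₃²`), so its rank is `8`. [cite: Dodson1987, Prop. 4.4 (2)(a)] -/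
theorem typeRank_eq_eight_of_primitive_of_weight_three (hτ : orderOf τ = 3) (hκ : orderOf κ = 3)
    (hτκ : κ ∉ Subgroup.zpowers τ) (hcard : Fintype.card G = 18) (h : IsCMTypeWith ρ (Φ : Set G))
    (hprim : ∀ u : G, u ≠ 1 → ¬ IsStableUnder Φ u)
    (hw : (Finset.univ.filter fun xy : ZMod 3 × ZMod 3 => τ ^ xy.1.val * κ ^ xy.2.val ∈ Φ).card = 3 ∨
      (Finset.univ.filter fun xy : ZMod 3 × ZMod 3 => τ ^ xy.1.val * κ ^ xy.2.val ∈ Φ).card = 6) :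
    typeRank G (Φ : Set G) = 8 := by
  have hcard' : Fintype.card G = 2 * 3 ^ 2 := by rw [hcard]; norm_num
  set M : Finset (ZMod 3 × ZMod 3) :=
    Finset.univ.filter fun ab : ZMod 3 × ZMod 3 => τ ^ ab.1.val * κ ^ ab.2.val ∈ Φ with hM
  have hmem : ∀ a b : ZMod 3, (a, b) ∈ M ↔ τ ^ a.val * κ ^ b.val ∈ Φ := fun a b => by
    simp only [hM, Finset.mem_filter, Finset.mem_univ, true_and]
  obtain ⟨hnτ, hnj⟩ := (forall_not_isStableUnder_iff (by norm_num) hτ hκ hτκ hcard' h).1 hprim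
  have hsτ : ¬ ∀ ab : ZMod 3 × ZMod 3, ab ∈ M ↔ (ab.1 + 1, ab.2) ∈ M := by
    intro H
    apply hnτ
    rw [isStableUnder_iff_coord (by norm_num) hτ hκ hτκ hcard' h]
    intro a b
    rw [tau_mul_coord' hτ, ← hmem, ← hmem]
    exact H (a, b)
  have hsj : ∀ j : ZMod 3, ¬ ∀ ab : ZMod 3 × ZMod 3, ab ∈ M ↔ (ab.1 + j, ab.2 + 1) ∈ M := by
    intro j H
    apply hnj j
    rw [isStableUnder_iff_coord (by norm_num) hτ hκ hτκ hcard' h]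
    intro a b
    rw [diag_mul_coord' hτ hκ, ← hmem, ← hmem]
    exact H (a, b)
  rw [typeRank_eq_eight_iff_of_primitive_three hτ hκ hτκ hcard h hprim]
  rcases three_points M hw hsτ hsj with H | ⟨j, H⟩
  · left
    intro y y'
    unfold rowCount
    simp_rw [← hmem]
    exact H y y'
  · right
    refine ⟨j, fun t t' => ?_⟩
    rw [rowCount_diag hτ hκ, rowCount_diag hτ hκ]
    simp_rw [← hmem]
    exact H t t'

/-- **The weight-`3` (or, generally, weight `0 < w < 9`) types in the `ℤ₃²`-orbits of order `3` have rank `4`**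
(Prop. 4.4 (2)(b): "twelve `f` in four `ℤ₃²`-orbits of order `3`" — the cosets of the four `ℤ₃ ⊂ ℤ₃²`).
[cite: Dodson1987, Prop. 4.4 (2)(b)] [cite: Kubota1965, §4 Lemma 2] -/
theorem typeRank_eq_four_of_exists_isStableUnder_of_weight (hτ : orderOf τ = 3) (hκ : orderOf κ = 3)
    (hτκ : κ ∉ Subgroup.zpowers τ) (hcard : Fintype.card G = 18) (h : IsCMTypeWith ρ (Φ : Set G))
    (hst : ∃ u : G, u ≠ 1 ∧ IsStableUnder Φ u)
    (hw0 : 0 < (Finset.univ.filter fun xy : ZMod 3 × ZMod 3 => τ ^ xy.1.val * κ ^ xy.2.val ∈ Φ).card)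
    (hw : (Finset.univ.filter fun xy : ZMod 3 × ZMod 3 => τ ^ xy.1.val * κ ^ xy.2.val ∈ Φ).card < 9) :
    typeRank G (Φ : Set G) = 4 :=
  typeRank_eq_of_exists_isStableUnder_of_weight (p := 3) (by norm_num) hτ hκ hτκ (by rw [hcard]; norm_num) h
    hst hw0 (by norm_num; exact hw)

end Three

end ElemSq

end CyclicCMType

end Literature.NumberTheory.ComplexMultiplication
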